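import Summits.ABC.ABC.Theorems.IneffectiveSubspaceDepthCountedABCStubCalibration

/-!
# Stub `stub_uniformQuarticThueOfCellZero` of line `Sketch` — crux `IneffectiveSubspace.DepthCountedABC` (stmt-ABC-14938)

THE WEAKEST OPEN FACE OF CELL 0, CONVERSE DIRECTION (lead c19).  Companion of `stub_cellZeroOfUniformQuarticThue`
(uniform binomial quartic Thue ⟹ abc at SOME exponent `2 − δ` on the 5-free cell): conversely, abc at exponent `2 − δ`
on the 5-free cell gives uniform binomial quartic Thue at every `η < 4δ/5` ON THE 5-FREE LOCUS — the positive coprime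
solutions of `a + u·Y⁴ = v·Z⁴` whose triple `(a, uY⁴, vZ⁴)` is 5-free (i.e. `Y, Z` squarefree, `gcd(u,Y) = gcd(v,Z) = 1`,
`a, u, v` 5-free) and which satisfy `a·u·v ≤ Z^η` have bounded `Z`.  Mechanism: the triple is an abc triple of the cell
with `rad ≤ a·u·v·Y·Z ≤ Z^(2 + 5η/4)` (`Y⁴ ≤ uY⁴ < vZ⁴ ≤ Z^(4+η)`) and `c = vZ⁴ ≥ Z⁴`, so `Z⁴ < C·Z^((2+5η/4)(2−δ)) ≤ C·Z^(4−κ)`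
with `κ = 2δ − 5η/2 > 0`, i.e. `Z < C^(1/κ)`.  Together the two stubs say: the first improvement of the free exponent 2 on
cell 0 is EXACTLY a uniform (polynomial in the coefficients) bound on the smallest solution of the binomial quartic Thue
equation `vZ⁴ − uY⁴ = a` — open in print (Thue–Siegel bounds the number of large solutions, Baker their size only
exponentially in the coefficients).

Sources: skeleton `Cruxes/DepthCountedABC/Lines/Sketch.lean` (lead c19, stub `stub_uniformQuarticThueOfCellZero`).  Mathlib
only (`UniqueFactorizationMonoid.radical_mul_dvd`, `radical_pow`, `Nat.radical_le_self_iff`, `Real.rpow_*`).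
-/

-- `Summit.<Summit>.<Problem>` is the mandated summit-side namespace (CONVENTIONS §2); for the
-- single-conjunct summit `ABC` the two coincide, so the duplicate `ABC.ABC` is deliberate.
set_option linter.dupNamespace false

namespace Summit.ABC.ABC.Theorems.DepthCountedABC

open UniqueFactorizationMonoid (radical) in
open Literature.NumberTheory.DiophantineGeometry (IsABCTriple rad rad_def) in
/-- **Stub `stub_uniformQuarticThueOfCellZero` (the weakest open face of cell 0, converse) of line `Sketch`, crux
`DepthCountedABC` (stmt-ABC-14938):** if abc holds with exponent `2 − δ` on the 5-free cell, then for every `η > 0`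
with `5η < 4δ` the positive coprime solutions of `a + u·Y⁴ = v·Z⁴` with 5-free `a·(uY⁴)·(vZ⁴)` and `a·u·v ≤ Z^η` have
bounded `Z`. [folklore reduction] -/
theorem stub_uniformQuarticThueOfCellZero : ∀ δ : ℝ, 0 < δ →
    (∃ C : ℝ, 0 < C ∧ ∀ a b c : ℕ, Literature.NumberTheory.DiophantineGeometry.IsABCTriple a b c →
      ((a * b * c).primeFactors.filter (fun p => 5 ≤ (a * b * c).factorization p)).card = 0 →
      (c : ℝ) < C * ((Literature.NumberTheory.DiophantineGeometry.rad a b c : ℕ) : ℝ) ^ (2 - δ)) →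
    ∀ η : ℝ, 0 < η → 5 * η < 4 * δ →
    ∃ B : ℕ, ∀ a u v Y Z : ℕ, 0 < a → 0 < u → 0 < v → 0 < Y → 0 < Z →
      a + u * Y ^ 4 = v * Z ^ 4 → Nat.Coprime (u * Y ^ 4) (v * Z ^ 4) →
      ((a * (u * Y ^ 4) * (v * Z ^ 4)).primeFactors.filter
          (fun p => 5 ≤ (a * (u * Y ^ 4) * (v * Z ^ 4)).factorization p)).card = 0 →
      ((a * u * v : ℕ) : ℝ) ≤ (Z : ℝ) ^ η → Z ≤ B := by
  intro δ hδ hC η hη hηδ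
  obtain ⟨C, hCpos, hC⟩ := hC
  -- the saving `κ` and the bound `B`
  set κ : ℝ := 2 * δ - 5 * η / 2 with hκ
  have hκpos : 0 < κ := by rw [hκ]; linarith
  set B : ℕ := ⌊C ^ (1 / κ)⌋₊ + ⌊C⌋₊ + 1 with hB
  refine ⟨B, ?_⟩
  intro a u v Y Z ha hu hv hY hZ hsum hcop h0 hauv
  -- the abc triple `(a, uY⁴, vZ⁴)` of the 5-free cell
  set b : ℕ := u * Y ^ 4 with hb
  set c : ℕ := v * Z ^ 4 with hc
  have hbpos : 0 < b := by positivity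
  have hcpos : 0 < c := by positivity
  have hab : Nat.Coprime a b := by
    have h1 : Nat.Coprime b (a + b) := by rw [hsum]; exact hcop
    rw [add_comm, Nat.coprime_self_add_right] at h1
    exact h1.symm
  have habc : IsABCTriple a b c := ⟨ha, hbpos, hsum, hab⟩
  have hlt := hC a b c habc h0
  -- `rad(abc) ≤ a·u·v·Y·Z`
  set R : ℕ := rad a b c with hR
  have hRle : R ≤ a * u * v * Y * Z := by
    have hrb : radical b ≤ u * Y := by
      have h1 : radical b ∣ radical u * radical (Y ^ 4) := UniqueFactorizationMonoid.radical_mul_dvd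
      rw [UniqueFactorizationMonoid.radical_pow Y (by norm_num : (4 : ℕ) ≠ 0)] at h1
      calc radical b ≤ radical u * radical Y := Nat.le_of_dvd (by positivity) h1
        _ ≤ u * Y := Nat.mul_le_mul (Nat.radical_le_self_iff.mpr hu.ne') (Nat.radical_le_self_iff.mpr hY.ne')
    have hrc : radical c ≤ v * Z := by
      have h1 : radical c ∣ radical v * radical (Z ^ 4) := UniqueFactorizationMonoid.radical_mul_dvd
      rw [UniqueFactorizationMonoid.radical_pow Z (by norm_num : (4 : ℕ) ≠ 0)] at h1
      calc radical c ≤ radical v * radical Z := Nat.le_of_dvd (by positivity) h1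
        _ ≤ v * Z := Nat.mul_le_mul (Nat.radical_le_self_iff.mpr hv.ne') (Nat.radical_le_self_iff.mpr hZ.ne')
    have hra : radical a ≤ a := Nat.radical_le_self_iff.mpr ha.ne'
    have h2 : radical (a * b * c) ≤ radical (a * b) * radical c :=
      Nat.le_of_dvd (by positivity) UniqueFactorizationMonoid.radical_mul_dvd
    have h3 : radical (a * b) ≤ radical a * radical b :=
      Nat.le_of_dvd (by positivity) UniqueFactorizationMonoid.radical_mul_dvd
    calc R = radical (a * b * c) := rad_def a b c
      _ ≤ radical a * radical b * radical c := h2.trans (Nat.mul_le_mul_right _ h3)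
      _ ≤ a * (u * Y) * (v * Z) := Nat.mul_le_mul (Nat.mul_le_mul hra hrb) hrc
      _ = a * u * v * Y * Z := by ring
  -- real bookkeeping
  have hZ1 : (1 : ℝ) ≤ (Z : ℝ) := by exact_mod_cast hZ
  have hZ0 : (0 : ℝ) < (Z : ℝ) := by linarith
  have hY0 : (0 : ℝ) ≤ (Y : ℝ) := by positivity
  have hR1 : (1 : ℝ) ≤ (R : ℝ) := by
    have : 1 ≤ R := by rw [hR, rad_def]; exact Nat.radical_pos _
    exact_mod_cast this
  have hcZ : (Z : ℝ) ^ (4 : ℕ) ≤ (c : ℝ) := by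
    have : Z ^ 4 ≤ c := Nat.le_mul_of_pos_left _ hv
    exact_mod_cast this
  -- from `(Z : ℝ) < T` with `T ≥ 0` to `Z ≤ ⌊T⌋₊`
  have floor_bound : ∀ T : ℝ, (Z : ℝ) < T → Z ≤ ⌊T⌋₊ := by
    intro T hT
    have h1 : (Z : ℝ) < (⌊T⌋₊ : ℕ) + 1 := hT.trans (Nat.lt_floor_add_one T)
    have h2 : Z < ⌊T⌋₊ + 1 := by exact_mod_cast h1
    omega
  by_cases hδ2 : δ ≤ 2
  · -- main case: `0 ≤ 2 − δ`
    have hδ2' : (0 : ℝ) ≤ 2 - δ := by linarith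
    -- `Y⁴ < Z^(4+η)`, hence `Y ≤ Z^(1+η/4)`
    have hY4nat : Y ^ 4 < (a * u * v) * Z ^ 4 := by
      have h1 : Y ^ 4 ≤ b := by rw [hb]; exact Nat.le_mul_of_pos_left _ hu
      have h2 : b < c := by omega
      have h3 : c ≤ (a * u * v) * Z ^ 4 := by
        rw [hc]; exact Nat.mul_le_mul_right _ (Nat.le_mul_of_pos_left v (by positivity))
      omega
    have hY4 : (Y : ℝ) ^ (4 : ℕ) ≤ (Z : ℝ) ^ (4 + η) := by
      have h1 : ((Y ^ 4 : ℕ) : ℝ) ≤ (((a * u * v) * Z ^ 4 : ℕ) : ℝ) := by exact_mod_cast hY4nat.le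
      push_cast at h1
      calc (Y : ℝ) ^ (4 : ℕ) ≤ ((a : ℝ) * u * v) * (Z : ℝ) ^ (4 : ℕ) := h1
        _ ≤ (Z : ℝ) ^ η * (Z : ℝ) ^ (4 : ℕ) := by
            apply mul_le_mul_of_nonneg_right _ (by positivity)
            exact_mod_cast hauv
        _ = (Z : ℝ) ^ (4 + η) := by
            rw [Real.rpow_add hZ0, ← Real.rpow_natCast (Z : ℝ) 4]; push_cast; ring
    have hYle : (Y : ℝ) ≤ (Z : ℝ) ^ (1 + η / 4) := by
      have h1 : ((Y : ℝ) ^ (4 : ℕ)) ^ ((1 : ℝ) / 4) ≤ ((Z : ℝ) ^ (4 + η)) ^ ((1 : ℝ) / 4) :=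
        Real.rpow_le_rpow (by positivity) hY4 (by norm_num)
      have h2 : ((Y : ℝ) ^ (4 : ℕ)) ^ ((1 : ℝ) / 4) = (Y : ℝ) := by
        rw [← Real.rpow_natCast, ← Real.rpow_mul hY0]; norm_num
      have h3 : ((Z : ℝ) ^ (4 + η)) ^ ((1 : ℝ) / 4) = (Z : ℝ) ^ (1 + η / 4) := by
        rw [← Real.rpow_mul hZ0.le]; congr 1; ring
      rw [h2, h3] at h1; exact h1
    -- `R ≤ Z^(2 + 5η/4)`
    have hRreal : (R : ℝ) ≤ (Z : ℝ) ^ (2 + 5 * η / 4) := by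
      have h1 : (R : ℝ) ≤ ((a : ℝ) * u * v) * Y * Z := by exact_mod_cast hRle
      have hauv' : (a : ℝ) * u * v ≤ (Z : ℝ) ^ η := by exact_mod_cast hauv
      have h2 : ((a : ℝ) * u * v) * Y * Z ≤ (Z : ℝ) ^ η * (Z : ℝ) ^ (1 + η / 4) * (Z : ℝ) :=
        mul_le_mul_of_nonneg_right (mul_le_mul hauv' hYle hY0 (by positivity)) hZ0.le
      have h3 : (Z : ℝ) ^ η * (Z : ℝ) ^ (1 + η / 4) * (Z : ℝ) = (Z : ℝ) ^ (2 + 5 * η / 4) := by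
        conv_lhs => rw [show (Z : ℝ) ^ η * (Z : ℝ) ^ (1 + η / 4) * (Z : ℝ) =
            (Z : ℝ) ^ η * (Z : ℝ) ^ (1 + η / 4) * (Z : ℝ) ^ (1 : ℝ) by rw [Real.rpow_one]]
        rw [← Real.rpow_add hZ0, ← Real.rpow_add hZ0]; congr 1; ring
      linarith [h1, h2, h3.le]
    -- `Z⁴ ≤ c < C·R^(2−δ) ≤ C·Z^(4−κ)`
    have hexp : (2 + 5 * η / 4) * (2 - δ) ≤ 4 - κ := by
      rw [hκ]; nlinarith [mul_pos hη hδ]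
    have hRpow : (R : ℝ) ^ (2 - δ) ≤ (Z : ℝ) ^ (4 - κ) :=
      calc (R : ℝ) ^ (2 - δ) ≤ ((Z : ℝ) ^ (2 + 5 * η / 4)) ^ (2 - δ) :=
            Real.rpow_le_rpow (by positivity) hRreal hδ2'
        _ = (Z : ℝ) ^ ((2 + 5 * η / 4) * (2 - δ)) := by rw [← Real.rpow_mul hZ0.le]
        _ ≤ (Z : ℝ) ^ (4 - κ) := Real.rpow_le_rpow_of_exponent_le hZ1 hexp
    have hZ4lt : (Z : ℝ) ^ (4 : ℕ) < C * (Z : ℝ) ^ (4 - κ) :=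
      calc (Z : ℝ) ^ (4 : ℕ) ≤ (c : ℝ) := hcZ
        _ < C * ((rad a b c : ℕ) : ℝ) ^ (2 - δ) := hlt
        _ = C * (R : ℝ) ^ (2 - δ) := by rw [hR]
        _ ≤ C * (Z : ℝ) ^ (4 - κ) := mul_le_mul_of_nonneg_left hRpow hCpos.le
    have hsplit : (Z : ℝ) ^ (4 : ℕ) = (Z : ℝ) ^ κ * (Z : ℝ) ^ (4 - κ) := by
      rw [← Real.rpow_add hZ0, ← Real.rpow_natCast (Z : ℝ) 4]; congr 1; push_cast; ring
    have hZκ : (Z : ℝ) ^ κ < C := by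
      rw [hsplit] at hZ4lt
      exact lt_of_mul_lt_mul_right hZ4lt (Real.rpow_nonneg hZ0.le _)
    have hZlt : (Z : ℝ) < C ^ (1 / κ) := by
      have h1 : ((Z : ℝ) ^ κ) ^ (1 / κ) < C ^ (1 / κ) :=
        Real.rpow_lt_rpow (Real.rpow_nonneg hZ0.le _) hZκ (by positivity)
      have h2 : ((Z : ℝ) ^ κ) ^ (1 / κ) = (Z : ℝ) := by
        rw [← Real.rpow_mul hZ0.le, mul_one_div_cancel hκpos.ne', Real.rpow_one]
      rw [h2] at h1; exact h1
    have := floor_bound _ hZlt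
    omega
  · -- degenerate case `δ > 2`: the hypothesis already bounds `c` by `C`
    push Not at hδ2
    have hRpow : (R : ℝ) ^ (2 - δ) ≤ 1 := Real.rpow_le_one_of_one_le_of_nonpos hR1 (by linarith)
    have hZC : (Z : ℝ) < C := by
      have h1 : (Z : ℝ) ≤ (Z : ℝ) ^ (4 : ℕ) := by
        calc (Z : ℝ) = (Z : ℝ) ^ (1 : ℕ) := (pow_one _).symm
          _ ≤ (Z : ℝ) ^ (4 : ℕ) := pow_le_pow_right₀ hZ1 (by norm_num)
      calc (Z : ℝ) ≤ (Z : ℝ) ^ (4 : ℕ) := h1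
        _ ≤ (c : ℝ) := hcZ
        _ < C * ((rad a b c : ℕ) : ℝ) ^ (2 - δ) := hlt
        _ = C * (R : ℝ) ^ (2 - δ) := by rw [hR]
        _ ≤ C * 1 := mul_le_mul_of_nonneg_left hRpow hCpos.le
        _ = C := mul_one C
    have := floor_bound _ hZC
    omega

end Summit.ABC.ABC.Theorems.DepthCountedABC
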